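import Summits.Ventures.LatticeQCDFlow.Scoring.WilsonFlowRK3ObservableRate
import HarnessLib

/-!
# Along ANY process of configurations, the joint statistics of the recorded flowed observable — in particular every lag product entering an autocorrelation estimate — converge to those of the exactly flowed observable as the integrator step is refined, with rate `O(1/m)` for Lipschitz observables

HONEST FRAMING: exact (Metropolis-corrected) sampling algorithms for lattice gauge theory;
figures of merit are autocorrelation/cost numbers at stated couplings and volumes; no
continuum-physics claim.

Venture `LatticeQCDFlow` (cell pub-lqcd), sub-topic `Scoring`; FANOUT row 16 (`su2-base`: `τ_int(Q)` and
`τ_int(t²E)` are functionals of the AUTOCOVARIANCES of the series `k ↦ Q(RK3_{t/m}^m U_k)` recorded along the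
sampler's chain `U_0, U_1, …`).  Seventh file of the RK3-CONVERGENCE packet (`WilsonFlowRK3Convergence`:
`tendsto_comp_iterate_wilsonFlowRK3`; `WilsonFlowRK3ObservableRate`: `dist_comp_iterate_wilsonFlowRK3_le_div`,
`exists_lipschitzWith_cloverCharge`).  NEW WORK of the cell (placement rule); nothing is cited as a fact; no number.
Printed counterpart, NAMED ONLY: none needed (dominated convergence and Lipschitz bookkeeping).

The previous files control ONE configuration (and means under one-time marginals).  An autocorrelation estimate
reads the recorded observable at SEVERAL times of a process — any process: a Markov chain of HMC or heat-bath
updates from any start, stationary or not.  This file transports the convergence and the rate to such joint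
statistics, for an arbitrary finite measure `ν` on an arbitrary sample space `Ω` and arbitrarily many measurable
configuration-valued coordinates `π i : Ω → SU(n)^E` (e.g. `Ω` = path space, `π i` = the `i`-th state).

## What is here (every `d`, `n`, `L ≥ 1`, flow time `t ≥ 0`)

* §1 **`tendsto_integral_jointObservable`** — for a finite index type `ι`, measurable coordinates `π : ι → Ω → SU(n)^E`,
  a continuous observable `F` and a continuous `g : (ι → ℝ) → ℝ`:
  `∫ g (i ↦ F (RK3_{t/m}^m (π i ω))) dν → ∫ g (i ↦ F (wilsonFlow t (π i ω))) dν` (dominated convergence: pointwise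
  convergence at every `ω` from `tendsto_comp_iterate_wilsonFlowRK3`, domination by the bound of `g` on the compact
  box `[−B, B]^ι`, `B` a bound of `F`).
* §2 **`tendsto_integral_mul_observable`** — the LAG PRODUCTS: for two measurable coordinates `X, Y : Ω → SU(n)^E`,
  `∫ F(RK3^m X) · F(RK3^m Y) dν → ∫ F(V_t X) · F(V_t Y) dν`; with §1 for the means this says every entry of the
  autocovariance function of the recorded series converges to that of the exactly flowed series.
* §3 **`abs_integral_mul_observable_sub_le_div`** — RATE for Lipschitz `F`: there is `C` with
  `|∫ F(RK3^m X) F(RK3^m Y) dν − ∫ F(V_t X) F(V_t Y) dν| ≤ C · ν(univ) / m` for all `m ≥ t`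
  (`|ab − a'b'| ≤ B(|a − a'| + |b − b'|)`); instance **`abs_integral_mul_rk3CloverCharge_sub_le_div`** for the flowed
  clover charge on `(ℤ/L)^4` (row 16's `Q`).

NOT CLAIMED: anything about the estimator `τ̂_int` itself (a ratio with a data-driven window — its continuity in
the autocovariances is scorer bookkeeping, not done here); stationarity or mixing of the process; the constants (fixed `d`, `L`, `n`; no volume-uniformity claimed); any
number.
-/

namespace Summit.Ventures.LatticeQCDFlow.Scoring

open Matrix Filter Topology Set MeasureTheory Literature.MathematicalPhysics.QuantumFieldTheory
open Literature.MathematicalPhysics.QuantumLattice (fundamentalRep cloverPseudoscalar)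

open scoped Matrix.Norms.Frobenius NNReal

-- The scoped Frobenius instances are definitionally the product structures, but only at default transparency
-- (as in Mathlib's `MatrixExponential` and `Scoring/WilsonFlowRK3Consistency`).
set_option backward.isDefEq.respectTransparency false

variable {d L n : ℕ} [NeZero L]

/-! ## §1 Joint statistics of the recorded observable at finitely many times -/

section Joint

variable {Ω : Type*} [MeasurableSpace Ω]

omit [NeZero L] in
/-- A continuous real observable on the compact configuration space is bounded. -/
theorem exists_bound_of_continuous_config {F : GaugeConfig d L (Matrix.specialUnitaryGroup (Fin n) ℂ) → ℝ}
    (hF : Continuous F) : ∃ B : ℝ, 0 ≤ B ∧ ∀ U, |F U| ≤ B := by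
  obtain ⟨C, hC⟩ := (isCompact_range hF).isBounded.subset_closedBall (0 : ℝ)
  refine ⟨max C 0, le_max_right _ _, fun U => ?_⟩
  have h := hC (mem_range_self U)
  rw [Metric.mem_closedBall, dist_zero_right, Real.norm_eq_abs] at h
  exact h.trans (le_max_left _ _)

/-- **Joint statistics converge.**  For every finite measure `ν` on any sample space, finitely many measurable
configuration-valued coordinates `π i`, a continuous observable `F` and a continuous function `g` of the vector
of readings: `∫ g (i ↦ F (RK3_{t/m}^m (π i ω))) dν → ∫ g (i ↦ F (wilsonFlow t (π i ω))) dν` as `m → ∞`. -/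
theorem tendsto_integral_jointObservable {ι : Type*} [Fintype ι]
    {π : ι → Ω → GaugeConfig d L (Matrix.specialUnitaryGroup (Fin n) ℂ)} (hπ : ∀ i, Measurable (π i))
    {F : GaugeConfig d L (Matrix.specialUnitaryGroup (Fin n) ℂ) → ℝ} (hF : Continuous F)
    {g : (ι → ℝ) → ℝ} (hg : Continuous g) (ν : Measure Ω) [IsFiniteMeasure ν] {t : ℝ} (ht : 0 ≤ t) :
    Tendsto (fun m : ℕ => ∫ ω, g (fun i => F ((wilsonFlowRK3 (t / m))^[m] (π i ω))) ∂ν) atTop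
      (𝓝 (∫ ω, g (fun i => F (wilsonFlow t (π i ω))) ∂ν)) := by
  obtain ⟨B, hB0, hB⟩ := exists_bound_of_continuous_config hF
  -- `g` is bounded on the compact box `[−B, B]^ι`, which contains every vector of readings
  have hbox : IsCompact (Set.pi univ fun _ : ι => Icc (-B) B) := isCompact_univ_pi fun _ => isCompact_Icc
  obtain ⟨C, hC⟩ := hbox.exists_bound_of_continuousOn hg.continuousOn
  have hmem : ∀ v : ι → ℝ, (∀ i, |v i| ≤ B) → v ∈ Set.pi univ fun _ : ι => Icc (-B) B :=
    fun v hv i _ => ⟨(abs_le.1 (hv i)).1, (abs_le.1 (hv i)).2⟩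
  refine tendsto_integral_of_dominated_convergence (fun _ => C) (fun m => ?_) (integrable_const C) (fun m => ?_) ?_
  · -- measurability of the `m`-th integrand
    have hc : Continuous fun v : ι → GaugeConfig d L (Matrix.specialUnitaryGroup (Fin n) ℂ) =>
        g (fun i => F ((wilsonFlowRK3 (t / m))^[m] (v i))) :=
      hg.comp (continuous_pi fun i =>
        (hF.comp (continuous_iterate_wilsonFlowRK3 _ m)).comp (continuous_apply i))
    exact (hc.measurable.comp (measurable_pi_iff.2 hπ)).aestronglyMeasurable
  · exact Eventually.of_forall fun ω => hC _ (hmem _ fun i => hB _)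
  · refine Eventually.of_forall fun ω => ?_
    have hv : Tendsto (fun m : ℕ => fun i => F ((wilsonFlowRK3 (t / m))^[m] (π i ω))) atTop
        (𝓝 fun i => F (wilsonFlow t (π i ω))) :=
      tendsto_pi_nhds.2 fun i => tendsto_comp_iterate_wilsonFlowRK3 hF ht (π i ω)
    exact (hg.tendsto _).comp hv

end Joint

/-! ## §2 Lag products (entries of the autocovariance function) -/

section Lag

variable {Ω : Type*} [MeasurableSpace Ω]

/-- **Lag products converge**: for two measurable configuration-valued coordinates `X, Y` (two times of a chain),
a continuous observable `F`, every finite measure `ν` and every `t ≥ 0`,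
`∫ F(RK3_{t/m}^m X) · F(RK3_{t/m}^m Y) dν → ∫ F(wilsonFlow t X) · F(wilsonFlow t Y) dν`. -/
theorem tendsto_integral_mul_observable {X Y : Ω → GaugeConfig d L (Matrix.specialUnitaryGroup (Fin n) ℂ)}
    (hX : Measurable X) (hY : Measurable Y)
    {F : GaugeConfig d L (Matrix.specialUnitaryGroup (Fin n) ℂ) → ℝ} (hF : Continuous F)
    (ν : Measure Ω) [IsFiniteMeasure ν] {t : ℝ} (ht : 0 ≤ t) :
    Tendsto (fun m : ℕ => ∫ ω, F ((wilsonFlowRK3 (t / m))^[m] (X ω)) * F ((wilsonFlowRK3 (t / m))^[m] (Y ω)) ∂ν)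
      atTop (𝓝 (∫ ω, F (wilsonFlow t (X ω)) * F (wilsonFlow t (Y ω)) ∂ν)) := by
  have h := tendsto_integral_jointObservable (ι := Fin 2) (π := fun i => if i = 0 then X else Y)
    (fun i => by
      by_cases hi : i = 0
      · simp only [hi, if_true]; exact hX
      · simp only [hi, if_false]; exact hY)
    hF (g := fun v : Fin 2 → ℝ => v 0 * v 1) ((continuous_apply 0).mul (continuous_apply 1)) ν ht
  simpa using h

/-- Means converge too (the one-time case of §1; cf. `tendsto_integral_comp_iterate_wilsonFlowRK3` for measures on
configurations): `∫ F(RK3_{t/m}^m X) dν → ∫ F(wilsonFlow t X) dν`. -/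
theorem tendsto_integral_observable {X : Ω → GaugeConfig d L (Matrix.specialUnitaryGroup (Fin n) ℂ)}
    (hX : Measurable X) {F : GaugeConfig d L (Matrix.specialUnitaryGroup (Fin n) ℂ) → ℝ} (hF : Continuous F)
    (ν : Measure Ω) [IsFiniteMeasure ν] {t : ℝ} (ht : 0 ≤ t) :
    Tendsto (fun m : ℕ => ∫ ω, F ((wilsonFlowRK3 (t / m))^[m] (X ω)) ∂ν) atTop
      (𝓝 (∫ ω, F (wilsonFlow t (X ω)) ∂ν)) := by
  have h := tendsto_integral_jointObservable (ι := Fin 1) (π := fun _ => X) (fun _ => hX) hF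
    (g := fun v : Fin 1 → ℝ => v 0) (continuous_apply 0) ν ht
  simpa using h

end Lag

/-! ## §3 Rate for Lipschitz observables -/

section Rate

variable {Ω : Type*} [MeasurableSpace Ω]

/-- `|a b − a' b'| ≤ B (|a − a'| + |b − b'|)` when `|a'|, |b| ≤ B`. -/
theorem abs_mul_sub_mul_le {a b a' b' B : ℝ} (ha' : |a'| ≤ B) (hb : |b| ≤ B) :
    |a * b - a' * b'| ≤ B * (|a - a'| + |b - b'|) := by
  have h : a * b - a' * b' = (a - a') * b + a' * (b - b') := by ring
  rw [h]
  calc |(a - a') * b + a' * (b - b')| ≤ |(a - a') * b| + |a' * (b - b')| := abs_add_le _ _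
    _ = |a - a'| * |b| + |a'| * |b - b'| := by rw [abs_mul, abs_mul]
    _ ≤ |a - a'| * B + B * |b - b'| := add_le_add (mul_le_mul_of_nonneg_left hb (abs_nonneg _))
        (mul_le_mul_of_nonneg_right ha' (abs_nonneg _))
    _ = B * (|a - a'| + |b - b'|) := by ring

/-- **Rate for lag products of a Lipschitz observable.**  For a `K`-Lipschitz real observable `F`, measurable
coordinates `X, Y`, a finite measure `ν` and `t ≥ 0`, there is `C` with
`|∫ F(RK3_{t/m}^m X) F(RK3_{t/m}^m Y) dν − ∫ F(V_t X) F(V_t Y) dν| ≤ C · ν(univ) / m` for all `m ≥ t`. -/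
theorem abs_integral_mul_observable_sub_le_div {X Y : Ω → GaugeConfig d L (Matrix.specialUnitaryGroup (Fin n) ℂ)}
    (hX : Measurable X) (hY : Measurable Y)
    {F : GaugeConfig d L (Matrix.specialUnitaryGroup (Fin n) ℂ) → ℝ} {K : ℝ≥0} (hF : LipschitzWith K F)
    (ν : Measure Ω) [IsFiniteMeasure ν] {t : ℝ} (ht : 0 ≤ t) :
    ∃ C : ℝ, 0 ≤ C ∧ ∀ m : ℕ, t ≤ m →
      |(∫ ω, F ((wilsonFlowRK3 (t / m))^[m] (X ω)) * F ((wilsonFlowRK3 (t / m))^[m] (Y ω)) ∂ν) -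
        ∫ ω, F (wilsonFlow t (X ω)) * F (wilsonFlow t (Y ω)) ∂ν| ≤ C * ν.real univ / m := by
  obtain ⟨B, hB0, hB⟩ := exists_bound_of_continuous_config hF.continuous
  obtain ⟨C, hC0, hC⟩ := dist_comp_iterate_wilsonFlowRK3_le_div hF ht
  refine ⟨B * (C + C), by positivity, fun m hm => ?_⟩
  -- integrability of both integrands (bounded and measurable on a finite measure space)
  have hmeas : ∀ G : GaugeConfig d L (Matrix.specialUnitaryGroup (Fin n) ℂ) →
      GaugeConfig d L (Matrix.specialUnitaryGroup (Fin n) ℂ), Continuous G →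
      Integrable (fun ω => F (G (X ω)) * F (G (Y ω))) ν := by
    intro G hG
    have hc1 : Measurable fun ω => F (G (X ω)) := (hF.continuous.comp hG).measurable.comp hX
    have hc2 : Measurable fun ω => F (G (Y ω)) := (hF.continuous.comp hG).measurable.comp hY
    refine Integrable.mono' (integrable_const (B * B)) (hc1.mul hc2).aestronglyMeasurable
      (Eventually.of_forall fun ω => ?_)
    rw [Real.norm_eq_abs, abs_mul]
    exact mul_le_mul (hB _) (hB _) (abs_nonneg _) hB0
  have hi1 := hmeas _ (continuous_iterate_wilsonFlowRK3 (t / m) m)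
  have hi2 := hmeas _ (continuous_wilsonFlow t)
  rw [← integral_sub hi1 hi2]
  have hb : ∀ᵐ ω ∂ν, ‖F ((wilsonFlowRK3 (t / m))^[m] (X ω)) * F ((wilsonFlowRK3 (t / m))^[m] (Y ω)) -
      F (wilsonFlow t (X ω)) * F (wilsonFlow t (Y ω))‖ ≤ B * (C + C) / m :=
    Eventually.of_forall fun ω => by
      rw [Real.norm_eq_abs]
      have h1 : |F ((wilsonFlowRK3 (t / m))^[m] (X ω)) - F (wilsonFlow t (X ω))| ≤ C / m := by
        rw [← Real.dist_eq]; exact hC m hm (X ω)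
      have h2 : |F ((wilsonFlowRK3 (t / m))^[m] (Y ω)) - F (wilsonFlow t (Y ω))| ≤ C / m := by
        rw [← Real.dist_eq]; exact hC m hm (Y ω)
      calc |F ((wilsonFlowRK3 (t / m))^[m] (X ω)) * F ((wilsonFlowRK3 (t / m))^[m] (Y ω)) -
            F (wilsonFlow t (X ω)) * F (wilsonFlow t (Y ω))|
          ≤ B * (|F ((wilsonFlowRK3 (t / m))^[m] (X ω)) - F (wilsonFlow t (X ω))| +
              |F ((wilsonFlowRK3 (t / m))^[m] (Y ω)) - F (wilsonFlow t (Y ω))|) :=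
            abs_mul_sub_mul_le (hB _) (hB _)
        _ ≤ B * (C / m + C / m) := mul_le_mul_of_nonneg_left (add_le_add h1 h2) hB0
        _ = B * (C + C) / m := by ring
  have h := norm_integral_le_of_norm_le_const hb
  rw [Real.norm_eq_abs] at h
  calc |∫ ω, (F ((wilsonFlowRK3 (t / m))^[m] (X ω)) * F ((wilsonFlowRK3 (t / m))^[m] (Y ω)) -
        F (wilsonFlow t (X ω)) * F (wilsonFlow t (Y ω))) ∂ν| ≤ B * (C + C) / m * ν.real univ := h
    _ = B * (C + C) * ν.real univ / m := by ring

/-- **Instance: the flowed clover charge on `(ℤ/L)^4`** (row 16's `Q`, `SU(n)` fundamental).  For measurable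
`X, Y : Ω → SU(n)^E`, a finite measure `ν` and `t ≥ 0`, there is `C` with
`|E_ν[Q_{t/m,m}(X) Q_{t/m,m}(Y)] − E_ν[Q_t(X) Q_t(Y)]| ≤ C ν(univ)/m` for all `m ≥ t`, where
`Q_{ε,m} = Σ_x P_x ∘ RK3_ε^m` and `Q_t = Σ_x P_x ∘ wilsonFlow t`. -/
theorem abs_integral_mul_rk3CloverCharge_sub_le_div {L n : ℕ} [NeZero L] {Ω : Type*} [MeasurableSpace Ω]
    {X Y : Ω → GaugeConfig 4 L (Matrix.specialUnitaryGroup (Fin n) ℂ)} (hX : Measurable X) (hY : Measurable Y)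
    (ν : Measure Ω) [IsFiniteMeasure ν] {t : ℝ} (ht : 0 ≤ t) :
    ∃ C : ℝ, 0 ≤ C ∧ ∀ m : ℕ, t ≤ m →
      |(∫ ω, (∑ x : Site 4 L, cloverPseudoscalar (fundamentalRep (Fin n)) x ((wilsonFlowRK3 (t / m))^[m] (X ω))) *
          (∑ x : Site 4 L, cloverPseudoscalar (fundamentalRep (Fin n)) x ((wilsonFlowRK3 (t / m))^[m] (Y ω))) ∂ν) -
        ∫ ω, (∑ x : Site 4 L, cloverPseudoscalar (fundamentalRep (Fin n)) x (wilsonFlow t (X ω))) *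
          (∑ x : Site 4 L, cloverPseudoscalar (fundamentalRep (Fin n)) x (wilsonFlow t (Y ω))) ∂ν| ≤
        C * ν.real univ / m := by
  obtain ⟨K, hK⟩ := exists_lipschitzWith_cloverCharge (L := L) (n := n)
  exact abs_integral_mul_observable_sub_le_div hX hY hK ν ht

end Rate

end Summit.Ventures.LatticeQCDFlow.Scoring
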